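import Literature.Probability.FitznerVanDerHofstad2017.NobleBlocksCov
import Literature.Probability.FitznerVanDerHofstad2017.NobleBlocksNT
import Literature.Probability.FitznerVanDerHofstad2017.NobleBlocksPrime
import HarnessLib

/-!
# Covariance of the percolation blocks, II: the non-trivial double triangles, the composites (5.4)–(5.5), the primed families — and the unconditional left-flank constancy

[FvdH17] = Fitzner–van der Hofstad, arXiv:1506.07977v2.  Continuation of `NobleBlocksCov` (the instance side of the
averaging bridge `BlockSummationAvg` for bond percolation on `ℤ^d`, `L = Letters.perc d p`,
`σ = Site.signedPerm π ε`, direction permutation `ρ` with `σ e_κ = e_{ρκ}`):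

* §T — tools: the pentagon letter `𝓟` is `σ`-invariant (`perc_P_signedPerm`, `perc_P_signedPerm_zero`);
  reindexing congruences for the internal-vertex sums (`tsum_congr_signedPerm`, `tsum₂_congr_signedPerm`,
  `mul_tsum₂_congr_signedPerm`) and **covariance of the composition** `comp_signedPerm`
  (`(M ∘ N)(σ·) = (M ∘ N)(·)` for covariant `M`, `N`, by reindexing the middle pair).
* §N — the non-trivial double triangles of App. B (v2 pp. 76–77) with their internal vertices `u, w` summed are
  covariant with the direction permuted along: `perc_blockBNT₀/BbarNT₀/BNT/BbarNT_signedPerm`.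
* §F — hence the COMPOSITES: `perc_blockB_signedPerm` / `perc_blockBbar_signedPerm` ((5.4)/(5.5) for any covariant
  parameter `B2` / `Bbar2`), `perc_blockBFull_signedPerm` / `perc_blockBbarFull_signedPerm` (pieces plugged in),
  their `κ`-sums (`sum_perc_blockBFull/BbarFull_signedPerm`) and the packaged `isCov₄_sum_perc_blockBFull/BbarFull`;
  and the **unconditional left-flank constancy for bond percolation** `isConstOn_gapSum_recP_percFull`: the gap
  aggregate `u ↦ Σ_x P^{(N),a}(x, x+u)` of every recursively built left piece (6.48)–(6.49) over `P^{S}` and the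
  full closed blocks `B^{κ,a,b}` is the same for all `2d` unit vectors `u` — the hypothesis `hPM` of
  `tsum_le_vecMul_pow_dotProduct_avg` with `U = unitVecs d`, now free of assumptions.
* §P — the primed families of `NobleBlocksPrime` (row `(0,0)` from §6.1): `perc_blockAiotaZero₀'_signedPerm`,
  `perc_blockAiota₀'/AiotaSt₀'/Abar₀'/AbarSt₀'_signedPerm`, `perc_blockAiota'/AiotaSt'/Abar'/AbarSt'_signedPerm`,
  `sum_perc_blockAbar'/AbarSt'_signedPerm`, `isCov₄_sum_perc_blockAbar'/AbarSt'`.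

Everything is `d`-generic and proved outright; no named facts.
-/

open Literature.Probability.LatticeModels Literature.Probability.Percolation
open scoped BigOperators ENNReal

namespace Literature.Probability.FitznerVanDerHofstad2017.NobleBlocks

open Literature.Probability.FitznerVanDerHofstad2017.BlockSummation
open Literature.Barriers.CriticalPhenomena (signedPerm_sub signedPerm_neg)

variable {d : ℕ}

local notation "𝐞" => Literature.Probability.Percolation.stepVec

/-! ### T. Tools: the pentagon letter, reindexing congruences, covariance of the composition -/

section Tools

variable (p : unitInterval) (π : Equiv.Perm (Fin d)) (ε : Fin d → ℤˣ)

/-- `𝓟(σx₁,…,σx₅) = 𝓟(x₁,…,x₅)`. [cite: FitznerVanDerHofstad2017, §4.2 (4.18) (arXiv:1506.07977v2 p. 36)] -/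
theorem perc_P_signedPerm (j₁ j₂ j₃ j₄ j₅ : LenIdx) (x₁ x₂ x₃ x₄ x₅ : Site d) :
    (Letters.perc d p).P j₁ j₂ j₃ j₄ j₅ (Site.signedPerm π ε x₁) (Site.signedPerm π ε x₂) (Site.signedPerm π ε x₃)
        (Site.signedPerm π ε x₄) (Site.signedPerm π ε x₅) = (Letters.perc d p).P j₁ j₂ j₃ j₄ j₅ x₁ x₂ x₃ x₄ x₅ := by
  simpa only [zdSignedPermIso_apply] using
    perc_P_iso p (zdSignedPermIso π ε) (by simp) j₁ j₂ j₃ j₄ j₅ x₁ x₂ x₃ x₄ x₅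

/-- `𝓟(σx₁,…,σx₄,0) = 𝓟(x₁,…,x₄,0)`. [cite: FitznerVanDerHofstad2017, §4.2 (4.18) (arXiv:1506.07977v2 p. 36)] -/
theorem perc_P_signedPerm_zero (j₁ j₂ j₃ j₄ j₅ : LenIdx) (x₁ x₂ x₃ x₄ : Site d) :
    (Letters.perc d p).P j₁ j₂ j₃ j₄ j₅ (Site.signedPerm π ε x₁) (Site.signedPerm π ε x₂) (Site.signedPerm π ε x₃)
        (Site.signedPerm π ε x₄) 0 = (Letters.perc d p).P j₁ j₂ j₃ j₄ j₅ x₁ x₂ x₃ x₄ 0 := by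
  simpa only [Site.signedPerm_zero] using perc_P_signedPerm p π ε j₁ j₂ j₃ j₄ j₅ x₁ x₂ x₃ x₄ 0

omit p in
/-- Reindexing one internal vertex along `σ`, as a congruence. [folklore] -/
theorem tsum_congr_signedPerm {f g : Site d → ℝ≥0∞} (h : ∀ t, f (Site.signedPerm π ε t) = g t) :
    ∑' t, f t = ∑' t, g t :=
  (tsum_signedPerm π ε f).symm.trans (tsum_congr h)

omit p in
/-- Reindexing two internal vertices along `σ`, as a congruence. [folklore] -/
theorem tsum₂_congr_signedPerm {f g : Site d → Site d → ℝ≥0∞}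
    (h : ∀ u w, f (Site.signedPerm π ε u) (Site.signedPerm π ε w) = g u w) :
    ∑' u, ∑' w, f u w = ∑' u, ∑' w, g u w :=
  tsum_congr_signedPerm π ε fun u => tsum_congr_signedPerm π ε fun w => h u w

omit p in
/-- The same behind a scalar. [folklore] -/
theorem mul_tsum₂_congr_signedPerm {c c' : ℝ≥0∞} {f g : Site d → Site d → ℝ≥0∞} (hc : c = c')
    (h : ∀ u w, f (Site.signedPerm π ε u) (Site.signedPerm π ε w) = g u w) :
    c * ∑' u, ∑' w, f u w = c' * ∑' u, ∑' w, g u w := by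
  rw [hc, tsum₂_congr_signedPerm π ε h]

omit p in
/-- **Covariance of the composition** `(M₁ ∘ N₁)(σu,σv,σx,σy) = (M₂ ∘ N₂)(u,v,x,y)` when `M₁(σ·) = M₂(·)` and
`N₁(σ·) = N₂(·)` (reindex the middle pair). [cite: FitznerVanDerHofstad2017, §5.1 (5.4) (arXiv:1506.07977v2 p. 48); §3.5 (Symmetry of the model) (p. 32)] -/
theorem comp_signedPerm {M₁ M₂ N₁ N₂ : Site d → Site d → Site d → Site d → ℝ≥0∞}
    (hM : ∀ u v x y, M₁ (Site.signedPerm π ε u) (Site.signedPerm π ε v) (Site.signedPerm π ε x)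
      (Site.signedPerm π ε y) = M₂ u v x y)
    (hN : ∀ u v x y, N₁ (Site.signedPerm π ε u) (Site.signedPerm π ε v) (Site.signedPerm π ε x)
      (Site.signedPerm π ε y) = N₂ u v x y) (u v x y : Site d) :
    comp M₁ N₁ (Site.signedPerm π ε u) (Site.signedPerm π ε v) (Site.signedPerm π ε x) (Site.signedPerm π ε y) =
      comp M₂ N₂ u v x y := by
  simp only [comp]
  exact tsum₂_congr_signedPerm π ε fun w t => by rw [hM, hN]

end Tools

/-! ### N. The non-trivial double triangles `B^{(2),ι,a,b}`, `B̄^{(2),ι,a,b}` are covariant -/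

section NonTrivial

variable (p : unitInterval) (π : Equiv.Perm (Fin d)) (ε : Fin d → ℤˣ) {ρ : Fin d × Bool → Fin d × Bool}

/-- **`B^{(2),ρκ,a,b}(0, σv, σx, σy) = B^{(2),κ,a,b}(0, v, x, y)`** when `σ e_κ = e_{ρκ}` (internal vertices
reindexed along `σ`). [cite: FitznerVanDerHofstad2017, App. B Table "Diagrams and definition of B^{(2),ι,a,b}(0,v,x,y)" (arXiv:1506.07977v2 p. 76); §3.5 (p. 32)] -/
theorem perc_blockBNT₀_signedPerm (hρ : ∀ κ, Site.signedPerm π ε (𝐞 κ) = 𝐞 (ρ κ)) (κ : Fin d × Bool)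
    (a b : Fin 3) (v x y : Site d) :
    blockBNT₀ (Letters.perc d p) (ρ κ) a b (Site.signedPerm π ε v) (Site.signedPerm π ε x) (Site.signedPerm π ε y) =
      blockBNT₀ (Letters.perc d p) κ a b v x y := by
  fin_cases a <;> fin_cases b <;> simp only [blockBNT₀] <;>
    first
      | exact mul_tsum₂_congr_signedPerm π ε (kd_signedPerm_zero π ε _) fun u w => by
          simp only [← hρ, kdc_signedPerm, ← signedPerm_sub, ← signedPerm_neg, twoDD_signedPerm,
            perc_S_signedPerm, perc_T_signedPerm_zero]
      | exact tsum₂_congr_signedPerm π ε fun u w => by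
          simp only [← hρ, ← signedPerm_sub, ← signedPerm_neg, twoDD_signedPerm, perc_T_signedPerm_zero,
            perc_P_signedPerm, perc_B_signedPerm]

/-- **`B̄^{(2),ρκ,a,b}(0, σv, σx, σy) = B̄^{(2),κ,a,b}(0, v, x, y)`** when `σ e_κ = e_{ρκ}`.
[cite: FitznerVanDerHofstad2017, App. B Tables "Diagram of the different cases of B̄^{(2),ι,a,b}(0,v,x,y)" (arXiv:1506.07977v2 p. 77); §3.5 (p. 32)] -/
theorem perc_blockBbarNT₀_signedPerm (hρ : ∀ κ, Site.signedPerm π ε (𝐞 κ) = 𝐞 (ρ κ)) (κ : Fin d × Bool)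
    (a b : Fin 3) (v x y : Site d) :
    blockBbarNT₀ (Letters.perc d p) (ρ κ) a b (Site.signedPerm π ε v) (Site.signedPerm π ε x)
      (Site.signedPerm π ε y) = blockBbarNT₀ (Letters.perc d p) κ a b v x y := by
  fin_cases a <;> fin_cases b <;> simp only [blockBbarNT₀] <;>
    first
      | exact mul_tsum₂_congr_signedPerm π ε (kd_signedPerm_zero π ε _) fun u w => by
          simp only [← hρ, kd_signedPerm, kdc_signedPerm, ← signedPerm_sub, ← signedPerm_neg,
            ← Site.signedPerm_add, perc_dbc_signedPerm, perc_S_signedPerm, perc_T_signedPerm_zero,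
            perc_P_signedPerm_zero]
      | exact tsum₂_congr_signedPerm π ε fun u w => by
          simp only [← hρ, kd_signedPerm, kdc_signedPerm, ← signedPerm_sub, ← signedPerm_neg,
            ← Site.signedPerm_add, twoDD_signedPerm, perc_dbc_signedPerm, perc_B_signedPerm, perc_T_signedPerm_zero,
            perc_P_signedPerm]

/-- **`B^{(2),ρκ,a,b}(σu, σv, σx, σy) = B^{(2),κ,a,b}(u, v, x, y)`**. [cite: FitznerVanDerHofstad2017, App. B (arXiv:1506.07977v2 p. 76); §3.5 (p. 32)] -/
theorem perc_blockBNT_signedPerm (hρ : ∀ κ, Site.signedPerm π ε (𝐞 κ) = 𝐞 (ρ κ)) (κ : Fin d × Bool)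
    (a b : Fin 3) (u v x y : Site d) :
    blockBNT (Letters.perc d p) (ρ κ) a b (Site.signedPerm π ε u) (Site.signedPerm π ε v) (Site.signedPerm π ε x)
      (Site.signedPerm π ε y) = blockBNT (Letters.perc d p) κ a b u v x y := by
  simp only [blockBNT, ofBase, ← signedPerm_sub, perc_blockBNT₀_signedPerm p π ε hρ]

/-- **`B̄^{(2),ρκ,a,b}(σu, σv, σx, σy) = B̄^{(2),κ,a,b}(u, v, x, y)`**. [cite: FitznerVanDerHofstad2017, App. B (arXiv:1506.07977v2 p. 77); §3.5 (p. 32)] -/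
theorem perc_blockBbarNT_signedPerm (hρ : ∀ κ, Site.signedPerm π ε (𝐞 κ) = 𝐞 (ρ κ)) (κ : Fin d × Bool)
    (a b : Fin 3) (u v x y : Site d) :
    blockBbarNT (Letters.perc d p) (ρ κ) a b (Site.signedPerm π ε u) (Site.signedPerm π ε v)
      (Site.signedPerm π ε x) (Site.signedPerm π ε y) = blockBbarNT (Letters.perc d p) κ a b u v x y := by
  simp only [blockBbarNT, ofBase, ← signedPerm_sub, perc_blockBbarNT₀_signedPerm p π ε hρ]

end NonTrivial

/-! ### F. The composites (5.4)–(5.5) and the unconditional left-flank constancy -/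

section Full

variable (p : unitInterval) (π : Equiv.Perm (Fin d)) (ε : Fin d → ℤˣ) {ρ : Fin d × Bool → Fin d × Bool}

/-- **`B^{ρκ,a,b}(σ·) = B^{κ,a,b}(·)` for (5.4)** with any parameter `B2` covariant in the same sense.
[cite: FitznerVanDerHofstad2017, §5.1 (5.4) (arXiv:1506.07977v2 p. 48); §3.5 (p. 32)] -/
theorem perc_blockB_signedPerm {B2 : DirBlockFamily d} (hρ : ∀ κ, Site.signedPerm π ε (𝐞 κ) = 𝐞 (ρ κ))
    (hB2 : ∀ κ a b u v x y, B2 (ρ κ) a b (Site.signedPerm π ε u) (Site.signedPerm π ε v) (Site.signedPerm π ε x)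
      (Site.signedPerm π ε y) = B2 κ a b u v x y) (κ : Fin d × Bool) (a b : Fin 3) (u v x y : Site d) :
    blockB (Letters.perc d p) B2 (ρ κ) a b (Site.signedPerm π ε u) (Site.signedPerm π ε v) (Site.signedPerm π ε x)
      (Site.signedPerm π ε y) = blockB (Letters.perc d p) B2 κ a b u v x y := by
  have h₁ : (∑ c, comp (blockAiotaSt (Letters.perc d p) (ρ κ) a c) (blockA (Letters.perc d p) c b)
      (Site.signedPerm π ε u) (Site.signedPerm π ε v) (Site.signedPerm π ε x) (Site.signedPerm π ε y)) =
      ∑ c, comp (blockAiotaSt (Letters.perc d p) κ a c) (blockA (Letters.perc d p) c b) u v x y :=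
    Finset.sum_congr rfl fun c _ =>
      comp_signedPerm π ε (perc_blockAiotaSt_signedPerm p π ε hρ κ a c) (perc_blockA_signedPerm p π ε c b) u v x y
  have h₂ : ∑' t, blockAiota (Letters.perc d p) (ρ κ) a b (Site.signedPerm π ε u) (Site.signedPerm π ε v)
      (Site.signedPerm π ε x) t * blockPS (Letters.perc d p) 0 (Site.signedPerm π ε y - t) (Site.signedPerm π ε y - t) =
      ∑' t, blockAiota (Letters.perc d p) κ a b u v x t * blockPS (Letters.perc d p) 0 (y - t) (y - t) :=
    tsum_congr_signedPerm π ε fun t => by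
      rw [perc_blockAiota_signedPerm p π ε hρ, ← signedPerm_sub, perc_blockPS_signedPerm]
  simp only [blockB, h₁, h₂, hB2]

/-- **`B̄^{ρκ,a,b}(σ·) = B̄^{κ,a,b}(·)` for (5.5)** with any parameter `Bbar2` covariant in the same sense.
[cite: FitznerVanDerHofstad2017, §5.1 (5.5) (arXiv:1506.07977v2 p. 48); §3.5 (p. 32)] -/
theorem perc_blockBbar_signedPerm {Bbar2 : DirBlockFamily d} (hρ : ∀ κ, Site.signedPerm π ε (𝐞 κ) = 𝐞 (ρ κ))
    (hB2 : ∀ κ a b u v x y, Bbar2 (ρ κ) a b (Site.signedPerm π ε u) (Site.signedPerm π ε v) (Site.signedPerm π ε x)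
      (Site.signedPerm π ε y) = Bbar2 κ a b u v x y) (κ : Fin d × Bool) (a b : Fin 3) (u v x y : Site d) :
    blockBbar (Letters.perc d p) Bbar2 (ρ κ) a b (Site.signedPerm π ε u) (Site.signedPerm π ε v)
      (Site.signedPerm π ε x) (Site.signedPerm π ε y) = blockBbar (Letters.perc d p) Bbar2 κ a b u v x y := by
  have h₁ : (∑ c, comp (blockAiota (Letters.perc d p) (ρ κ) a c) (blockAst (Letters.perc d p) c b)
      (Site.signedPerm π ε u) (Site.signedPerm π ε v) (Site.signedPerm π ε x) (Site.signedPerm π ε y)) =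
      ∑ c, comp (blockAiota (Letters.perc d p) κ a c) (blockAst (Letters.perc d p) c b) u v x y :=
    Finset.sum_congr rfl fun c _ =>
      comp_signedPerm π ε (perc_blockAiota_signedPerm p π ε hρ κ a c) (perc_blockAst_signedPerm p π ε c b) u v x y
  simp only [blockBbar, h₁, perc_blockAiota_signedPerm p π ε hρ, hB2]

/-- **`B^{ρκ,a,b}(σ·) = B^{κ,a,b}(·)`, pieces plugged in** (`blockBFull = blockB L (blockBNT L)`).
[cite: FitznerVanDerHofstad2017, §5.1 (5.4) (arXiv:1506.07977v2 p. 48); App. B (p. 76); §3.5 (p. 32)] -/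
theorem perc_blockBFull_signedPerm (hρ : ∀ κ, Site.signedPerm π ε (𝐞 κ) = 𝐞 (ρ κ)) (κ : Fin d × Bool)
    (a b : Fin 3) (u v x y : Site d) :
    blockBFull (Letters.perc d p) (ρ κ) a b (Site.signedPerm π ε u) (Site.signedPerm π ε v) (Site.signedPerm π ε x)
      (Site.signedPerm π ε y) = blockBFull (Letters.perc d p) κ a b u v x y :=
  perc_blockB_signedPerm p π ε hρ (perc_blockBNT_signedPerm p π ε hρ) κ a b u v x y

/-- **`B̄^{ρκ,a,b}(σ·) = B̄^{κ,a,b}(·)`, pieces plugged in** (`blockBbarFull = blockBbar L (blockBbarNT L)`).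
[cite: FitznerVanDerHofstad2017, §5.1 (5.5) (arXiv:1506.07977v2 p. 48); App. B (p. 77); §3.5 (p. 32)] -/
theorem perc_blockBbarFull_signedPerm (hρ : ∀ κ, Site.signedPerm π ε (𝐞 κ) = 𝐞 (ρ κ)) (κ : Fin d × Bool)
    (a b : Fin 3) (u v x y : Site d) :
    blockBbarFull (Letters.perc d p) (ρ κ) a b (Site.signedPerm π ε u) (Site.signedPerm π ε v)
      (Site.signedPerm π ε x) (Site.signedPerm π ε y) = blockBbarFull (Letters.perc d p) κ a b u v x y :=
  perc_blockBbar_signedPerm p π ε hρ (perc_blockBbarNT_signedPerm p π ε hρ) κ a b u v x y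

/-- **`Σ_κ B^{κ,a,b}(σ·) = Σ_κ B^{κ,a,b}(·)`** (pieces plugged in). [cite: FitznerVanDerHofstad2017, §5.1 (5.4) (arXiv:1506.07977v2 p. 48); §6.1 p. 59] -/
theorem sum_perc_blockBFull_signedPerm (a b : Fin 3) (u v x y : Site d) :
    ∑ κ, blockBFull (Letters.perc d p) κ a b (Site.signedPerm π ε u) (Site.signedPerm π ε v)
        (Site.signedPerm π ε x) (Site.signedPerm π ε y) = ∑ κ, blockBFull (Letters.perc d p) κ a b u v x y := by
  obtain ⟨σ, hσ⟩ := exists_stepVec_perm π ε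
  rw [← Equiv.sum_comp σ (fun κ => blockBFull (Letters.perc d p) κ a b (Site.signedPerm π ε u)
    (Site.signedPerm π ε v) (Site.signedPerm π ε x) (Site.signedPerm π ε y))]
  exact Finset.sum_congr rfl fun κ _ => perc_blockBFull_signedPerm p π ε hσ κ a b u v x y

/-- **`Σ_κ B̄^{κ,a,b}(σ·) = Σ_κ B̄^{κ,a,b}(·)`** (pieces plugged in). [cite: FitznerVanDerHofstad2017, §5.1 (5.5) (arXiv:1506.07977v2 p. 48); §6.1 p. 59] -/
theorem sum_perc_blockBbarFull_signedPerm (a b : Fin 3) (u v x y : Site d) :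
    ∑ κ, blockBbarFull (Letters.perc d p) κ a b (Site.signedPerm π ε u) (Site.signedPerm π ε v)
        (Site.signedPerm π ε x) (Site.signedPerm π ε y) = ∑ κ, blockBbarFull (Letters.perc d p) κ a b u v x y := by
  obtain ⟨σ, hσ⟩ := exists_stepVec_perm π ε
  rw [← Equiv.sum_comp σ (fun κ => blockBbarFull (Letters.perc d p) κ a b (Site.signedPerm π ε u)
    (Site.signedPerm π ε v) (Site.signedPerm π ε x) (Site.signedPerm π ε y))]
  exact Finset.sum_congr rfl fun κ _ => perc_blockBbarFull_signedPerm p π ε hσ κ a b u v x y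

omit π ε in
/-- `Σ_κ B^{κ,a,b}` (pieces plugged in) is `W_d`-covariant — the hypothesis `hB` of `isCov₂_recP` /
`isConstOn_gapSum_recP` for bond percolation. [cite: FitznerVanDerHofstad2017, §6.2.1 (6.48)–(6.49) (arXiv:1506.07977v2 p. 65); §6.1 p. 59] -/
theorem isCov₄_sum_perc_blockBFull (a b : Fin 3) :
    IsCov₄ (signedPermAddEquivs d) (fun u v x y => ∑ κ, blockBFull (Letters.perc d p) κ a b u v x y) :=
  isCov₄_signedPermAddEquivs_iff.2 fun π ε u v x y => sum_perc_blockBFull_signedPerm p π ε a b u v x y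

omit π ε in
/-- `Σ_κ B̄^{κ,a,b}` (pieces plugged in) is `W_d`-covariant. [cite: FitznerVanDerHofstad2017, §5.1 (5.5) (arXiv:1506.07977v2 p. 48); §6.1 p. 59] -/
theorem isCov₄_sum_perc_blockBbarFull (a b : Fin 3) :
    IsCov₄ (signedPermAddEquivs d) (fun u v x y => ∑ κ, blockBbarFull (Letters.perc d p) κ a b u v x y) :=
  isCov₄_signedPermAddEquivs_iff.2 fun π ε u v x y => sum_perc_blockBbarFull_signedPerm p π ε a b u v x y

omit π ε in
/-- Every recursively built left piece `P^{(N),a}` (6.48)–(6.49) over the percolation start triangles and the full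
closed blocks is `W_d`-covariant. [cite: FitznerVanDerHofstad2017, §6.2.1 (6.48)–(6.49) (arXiv:1506.07977v2 p. 65); §3.5 (p. 32)] -/
theorem isCov₂_recP_percFull (N : ℕ) (a : Fin 3) :
    IsCov₂ (signedPermAddEquivs d) (recP (blockPS (Letters.perc d p)) (blockBFull (Letters.perc d p)) N a) :=
  isCov₂_recP _ _ (isCov₂_perc_blockPS p) _ (isCov₄_sum_perc_blockBFull p) N a

omit π ε in
/-- **Unconditional left-flank constancy for bond percolation**: the gap aggregate
`u ↦ Σ_x P^{(N),a}(x, x+u)` of every recursively built left piece over `P^{S}` and the full closed blocks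
`B^{κ,a,b}` takes the same value on all `2d` unit vectors (hypothesis `hPM` of `tsum_le_vecMul_pow_dotProduct_avg`
with `U = unitVecs d`). [cite: FitznerVanDerHofstad2017, §6.1 p. 59 ("u and w are neighbors"); §6.2.1 (6.48)–(6.49) (arXiv:1506.07977v2 p. 65)] -/
theorem isConstOn_gapSum_recP_percFull (N : ℕ) (a : Fin 3) :
    IsConstOn (unitVecs d) (gapSum (recP (blockPS (Letters.perc d p)) (blockBFull (Letters.perc d p)) N a)) :=
  isConstOn_gapSum_recP_perc p _ (isCov₄_sum_perc_blockBFull p) N a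

end Full

/-! ### P. The primed families (row `(0,0)` from §6.1) -/

section Primed

variable (p : unitInterval) (π : Equiv.Perm (Fin d)) (ε : Fin d → ℤˣ) {ρ : Fin d × Bool → Fin d × Bool}

/-- The §6.1 row `(0,0)` is covariant with the direction permuted along. [cite: FitznerVanDerHofstad2017, §6.1 (Bound-Xi-case-abZero) (arXiv:1506.07977v2 p. 59); §3.5 (p. 32)] -/
theorem perc_blockAiotaZero₀'_signedPerm (hρ : ∀ κ, Site.signedPerm π ε (𝐞 κ) = 𝐞 (ρ κ)) (κ : Fin d × Bool)
    (v x y : Site d) :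
    blockAiotaZero₀' (Letters.perc d p) (ρ κ) (Site.signedPerm π ε v) (Site.signedPerm π ε x) (Site.signedPerm π ε y) =
      blockAiotaZero₀' (Letters.perc d p) κ v x y := by
  simp only [blockAiotaZero₀', ← hρ, kd_signedPerm, kd_signedPerm_zero, kdc_signedPerm, perc_T_signedPerm_zero]

/-- `A'^{ρκ,a,b}(0, σ·) = A'^{κ,a,b}(0, ·)` (primed). [cite: FitznerVanDerHofstad2017, App. B (arXiv:1506.07977v2 p. 75); §6.1 (p. 59); §3.5 (p. 32)] -/
theorem perc_blockAiota₀'_signedPerm (hρ : ∀ κ, Site.signedPerm π ε (𝐞 κ) = 𝐞 (ρ κ)) (κ : Fin d × Bool)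
    (a b : Fin 3) (v x y : Site d) :
    blockAiota₀' (Letters.perc d p) (ρ κ) a b (Site.signedPerm π ε v) (Site.signedPerm π ε x)
      (Site.signedPerm π ε y) = blockAiota₀' (Letters.perc d p) κ a b v x y := by
  by_cases h : a = 0 ∧ b = 0 <;>
    simp only [blockAiota₀', h, if_true, if_false, and_self, perc_blockAiotaZero₀'_signedPerm p π ε hρ,
      perc_blockAiota₀_signedPerm p π ε hρ]

/-- `A'^{ρκ,a,b,*}(0, σ·) = A'^{κ,a,b,*}(0, ·)` (primed). [cite: FitznerVanDerHofstad2017, App. B (arXiv:1506.07977v2 p. 75); §6.1 (p. 59); §3.5 (p. 32)] -/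
theorem perc_blockAiotaSt₀'_signedPerm (hρ : ∀ κ, Site.signedPerm π ε (𝐞 κ) = 𝐞 (ρ κ)) (κ : Fin d × Bool)
    (a b : Fin 3) (v x y : Site d) :
    blockAiotaSt₀' (Letters.perc d p) (ρ κ) a b (Site.signedPerm π ε v) (Site.signedPerm π ε x)
      (Site.signedPerm π ε y) = blockAiotaSt₀' (Letters.perc d p) κ a b v x y := by
  by_cases h : a = 0 ∧ b = 0 <;>
    simp only [blockAiotaSt₀', h, if_true, if_false, and_self, perc_blockAiotaZero₀'_signedPerm p π ε hρ,
      perc_blockAiotaSt₀_signedPerm p π ε hρ]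

/-- `Ā'^{ρκ,a,b}(0, σ·) = Ā'^{κ,a,b}(0, ·)` (primed). [cite: FitznerVanDerHofstad2017, App. B (arXiv:1506.07977v2 p. 78); §6.1 (p. 59); §3.5 (p. 32)] -/
theorem perc_blockAbar₀'_signedPerm (hρ : ∀ κ, Site.signedPerm π ε (𝐞 κ) = 𝐞 (ρ κ)) (κ : Fin d × Bool)
    (a b : Fin 3) (v x y : Site d) :
    blockAbar₀' (Letters.perc d p) (ρ κ) a b (Site.signedPerm π ε v) (Site.signedPerm π ε x)
      (Site.signedPerm π ε y) = blockAbar₀' (Letters.perc d p) κ a b v x y := by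
  by_cases h : a = 0 ∧ b = 0 <;>
    simp only [blockAbar₀', h, if_true, if_false, and_self, perc_blockAiotaZero₀'_signedPerm p π ε hρ,
      perc_blockAbar₀_signedPerm p π ε hρ]

/-- `Ā'^{ρκ,a,b,*}(0, σ·) = Ā'^{κ,a,b,*}(0, ·)` (primed). [cite: FitznerVanDerHofstad2017, §5.1 (arXiv:1506.07977v2 p. 47); App. B (p. 78); §6.1 (p. 59); §3.5 (p. 32)] -/
theorem perc_blockAbarSt₀'_signedPerm (hρ : ∀ κ, Site.signedPerm π ε (𝐞 κ) = 𝐞 (ρ κ)) (κ : Fin d × Bool)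
    (a b : Fin 3) (v x y : Site d) :
    blockAbarSt₀' (Letters.perc d p) (ρ κ) a b (Site.signedPerm π ε v) (Site.signedPerm π ε x)
      (Site.signedPerm π ε y) = blockAbarSt₀' (Letters.perc d p) κ a b v x y := by
  by_cases h : a = 0 ∧ b = 0 <;>
    simp only [blockAbarSt₀', h, if_true, if_false, and_self, perc_blockAiotaZero₀'_signedPerm p π ε hρ,
      perc_blockAbarSt₀_signedPerm p π ε hρ]

/-- `A'^{ρκ,a,b}(σ·) = A'^{κ,a,b}(·)` (general base point). [cite: FitznerVanDerHofstad2017, App. B (arXiv:1506.07977v2 p. 75); §6.1 (p. 59)] -/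
theorem perc_blockAiota'_signedPerm (hρ : ∀ κ, Site.signedPerm π ε (𝐞 κ) = 𝐞 (ρ κ)) (κ : Fin d × Bool)
    (a b : Fin 3) (u v x y : Site d) :
    blockAiota' (Letters.perc d p) (ρ κ) a b (Site.signedPerm π ε u) (Site.signedPerm π ε v)
      (Site.signedPerm π ε x) (Site.signedPerm π ε y) = blockAiota' (Letters.perc d p) κ a b u v x y := by
  simp only [blockAiota', ofBase, ← signedPerm_sub, perc_blockAiota₀'_signedPerm p π ε hρ]

/-- `A'^{ρκ,a,b,*}(σ·) = A'^{κ,a,b,*}(·)` (general base point). [cite: FitznerVanDerHofstad2017, App. B (arXiv:1506.07977v2 p. 75); §6.1 (p. 59)] -/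
theorem perc_blockAiotaSt'_signedPerm (hρ : ∀ κ, Site.signedPerm π ε (𝐞 κ) = 𝐞 (ρ κ)) (κ : Fin d × Bool)
    (a b : Fin 3) (u v x y : Site d) :
    blockAiotaSt' (Letters.perc d p) (ρ κ) a b (Site.signedPerm π ε u) (Site.signedPerm π ε v)
      (Site.signedPerm π ε x) (Site.signedPerm π ε y) = blockAiotaSt' (Letters.perc d p) κ a b u v x y := by
  simp only [blockAiotaSt', ofBase, ← signedPerm_sub, perc_blockAiotaSt₀'_signedPerm p π ε hρ]

/-- `Ā'^{ρκ,a,b}(σ·) = Ā'^{κ,a,b}(·)` (general base point). [cite: FitznerVanDerHofstad2017, App. B (arXiv:1506.07977v2 p. 78); §6.1 (p. 59)] -/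
theorem perc_blockAbar'_signedPerm (hρ : ∀ κ, Site.signedPerm π ε (𝐞 κ) = 𝐞 (ρ κ)) (κ : Fin d × Bool)
    (a b : Fin 3) (u v x y : Site d) :
    blockAbar' (Letters.perc d p) (ρ κ) a b (Site.signedPerm π ε u) (Site.signedPerm π ε v)
      (Site.signedPerm π ε x) (Site.signedPerm π ε y) = blockAbar' (Letters.perc d p) κ a b u v x y := by
  simp only [blockAbar', ofBase, ← signedPerm_sub, perc_blockAbar₀'_signedPerm p π ε hρ]

/-- `Ā'^{ρκ,a,b,*}(σ·) = Ā'^{κ,a,b,*}(·)` (general base point). [cite: FitznerVanDerHofstad2017, App. B (arXiv:1506.07977v2 p. 78); §6.1 (p. 59)] -/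
theorem perc_blockAbarSt'_signedPerm (hρ : ∀ κ, Site.signedPerm π ε (𝐞 κ) = 𝐞 (ρ κ)) (κ : Fin d × Bool)
    (a b : Fin 3) (u v x y : Site d) :
    blockAbarSt' (Letters.perc d p) (ρ κ) a b (Site.signedPerm π ε u) (Site.signedPerm π ε v)
      (Site.signedPerm π ε x) (Site.signedPerm π ε y) = blockAbarSt' (Letters.perc d p) κ a b u v x y := by
  simp only [blockAbarSt', ofBase, ← signedPerm_sub, perc_blockAbarSt₀'_signedPerm p π ε hρ]

/-- **`Σ_κ Ā'^{κ,a,b}(σ·) = Σ_κ Ā'^{κ,a,b}(·)`** (primed). [cite: FitznerVanDerHofstad2017, App. B (arXiv:1506.07977v2 p. 78); §6.1 (p. 59)] -/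
theorem sum_perc_blockAbar'_signedPerm (a b : Fin 3) (u v x y : Site d) :
    ∑ κ, blockAbar' (Letters.perc d p) κ a b (Site.signedPerm π ε u) (Site.signedPerm π ε v)
        (Site.signedPerm π ε x) (Site.signedPerm π ε y) = ∑ κ, blockAbar' (Letters.perc d p) κ a b u v x y := by
  obtain ⟨σ, hσ⟩ := exists_stepVec_perm π ε
  rw [← Equiv.sum_comp σ (fun κ => blockAbar' (Letters.perc d p) κ a b (Site.signedPerm π ε u)
    (Site.signedPerm π ε v) (Site.signedPerm π ε x) (Site.signedPerm π ε y))]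
  exact Finset.sum_congr rfl fun κ _ => perc_blockAbar'_signedPerm p π ε hσ κ a b u v x y

/-- **`Σ_κ Ā'^{κ,a,b,*}(σ·) = Σ_κ Ā'^{κ,a,b,*}(·)`** (primed). [cite: FitznerVanDerHofstad2017, App. B (arXiv:1506.07977v2 p. 78); §6.1 (p. 59)] -/
theorem sum_perc_blockAbarSt'_signedPerm (a b : Fin 3) (u v x y : Site d) :
    ∑ κ, blockAbarSt' (Letters.perc d p) κ a b (Site.signedPerm π ε u) (Site.signedPerm π ε v)
        (Site.signedPerm π ε x) (Site.signedPerm π ε y) = ∑ κ, blockAbarSt' (Letters.perc d p) κ a b u v x y := by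
  obtain ⟨σ, hσ⟩ := exists_stepVec_perm π ε
  rw [← Equiv.sum_comp σ (fun κ => blockAbarSt' (Letters.perc d p) κ a b (Site.signedPerm π ε u)
    (Site.signedPerm π ε v) (Site.signedPerm π ε x) (Site.signedPerm π ε y))]
  exact Finset.sum_congr rfl fun κ _ => perc_blockAbarSt'_signedPerm p π ε hσ κ a b u v x y

omit π ε in
/-- `Σ_κ Ā'^{κ,a,b}` (primed) is `W_d`-covariant. [cite: FitznerVanDerHofstad2017, §6.1 p. 59 (arXiv:1506.07977v2)] -/
theorem isCov₄_sum_perc_blockAbar' (a b : Fin 3) :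
    IsCov₄ (signedPermAddEquivs d) (fun u v x y => ∑ κ, blockAbar' (Letters.perc d p) κ a b u v x y) :=
  isCov₄_signedPermAddEquivs_iff.2 fun π ε u v x y => sum_perc_blockAbar'_signedPerm p π ε a b u v x y

omit π ε in
/-- `Σ_κ Ā'^{κ,a,b,*}` (primed) is `W_d`-covariant. [cite: FitznerVanDerHofstad2017, §6.1 p. 59 (arXiv:1506.07977v2)] -/
theorem isCov₄_sum_perc_blockAbarSt' (a b : Fin 3) :
    IsCov₄ (signedPermAddEquivs d) (fun u v x y => ∑ κ, blockAbarSt' (Letters.perc d p) κ a b u v x y) :=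
  isCov₄_signedPermAddEquivs_iff.2 fun π ε u v x y => sum_perc_blockAbarSt'_signedPerm p π ε a b u v x y

end Primed

end Literature.Probability.FitznerVanDerHofstad2017.NobleBlocks
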